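import Summits.QuantumAdvantage.QuantumAdvantage.Theorems.CubicForrelationNearExactIsExactTwelveTypeOPairWild

/-!
# Crux `CubicForrelation.NearExactIsExact` (stmt-QuantumAdvantage-14043) — n = 12, (O,O) pairs: PARITY TRANSFER — the wild function's Fourier
  coefficients `v̂/4` are all odd or all even (the 16-digit of the cubic support `κ₁` is all-or-nothing)

Certificate seat `b2b-cforr-cert` (gen 30).  HONEST FRAMING: a kernel-checked finite-slice structure lemma (standard axioms) for the wild (O,O) world
(PLAN-N12-WINDOW-OO.md §4 (W2)); nothing excluded, NO value of `θ₁₂`, NOT summit progress.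

In the setting of `topw_master` (both sides type O, `κ₁` cubic, `τ₁ = (−1)^{b₁}(−1)^{c₁·x}(1 − 4[κ₁ x]) + 8v₁`):
* `topp_vhat_formula`: `Σ_x v₁(x)(−1)^{x·y} = 4·k(y)` with the EXPLICIT integer
  `k(y) = (−1)^{b₁}(128[y = c₁] − w(c₁ ⊕ y)) − 2(−1)^{b₂}(−1)^{c₂·y}(1 − 4[κ₂ y]) − 16 v₂(y)`, where `W_{κ₁} = 16w` — so `k(y) ≡ w(c₁ ⊕ y) (mod 2)`.
* `topp_parity_dichotomy`: EITHER every `v̂₁(y)/4` is odd (then `κ₁` is of type O) OR every `v̂₁(y)/4` is even, i.e. `8 ∣ v̂₁(y)` for all `y`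
  (`κ₁` of level `≥ 5`) — by `TypeOTwelve.typeO_of_exists_odd` for the cubic `κ₁`.

References: J. Ax (1964) / R. J. McEliece (1972); MacWilliams–Sloane (1977) Ch. 15.  Axioms: the standard three.
-/

set_option linter.dupNamespace false -- D-0017: single-problem summit ⇒ `QuantumAdvantage.QuantumAdvantage` by design

noncomputable section

namespace Summit.QuantumAdvantage.QuantumAdvantage.Theorems.CubicForrelation.NearExactIsExact

open Finset
open Literature.Computability.QuantumComplexity
open Literature.Computability.QuantumComplexity.BuzetChailloux (bxor zeroVec bxor_bxor_cancel_left bxor_zeroVec zeroVec_bxor bxor_comm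
  bxor_self twist_bxor_right twist_zeroVec_right sum_twist_left bxor_eq_zeroVec_iff)
open Literature.Computability.QuantumComplexity.DerivativeWalsh (W)

/-- **Explicit formula for `v̂₁/4`.**  With `W_{κ₁} = 16w`: `Σ_x v₁(x)(−1)^{x·y} = 4·((−1)^{b₁}(128[y = c₁] − w(c₁⊕y)) − 2(−1)^{b₂}T(1 − 4[κ₂ y]) − 16v₂(y))`
where `T = (−1)^{c₂·y}` as an integer. [this work] -/
theorem topp_vhat_formula (F₁ F₂ : (Fin (6 + 6) → Bool) → Bool) (u₁ u₂ v₁ v₂ w : (Fin (6 + 6) → Bool) → ℤ)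
    (hu₁ : ∀ x, W (fun y => signOf (F₁ y)) x = (2 : ℝ) ^ 4 * (u₁ x : ℝ))
    (hu₂ : ∀ y, W (fun x => signOf (F₂ x)) y = (2 : ℝ) ^ 4 * (u₂ y : ℝ))
    (κ₁ κ₂ : (Fin (6 + 6) → Bool) → Bool) (hw : ∀ z, W (fun x => signOf (κ₁ x)) z = (2 : ℝ) ^ 4 * (w z : ℝ))
    (b₁ b₂ : Bool) (c₁ c₂ : Fin (6 + 6) → Bool)
    (h₁ : ∀ x, (((u₁ x - 4 * sZ (F₂ x) : ℤ)) : ℝ) = signOf b₁ * twist c₁ x * (1 - 4 * (if κ₁ x = true then 1 else 0)) + 8 * (v₁ x : ℝ))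
    (h₂ : ∀ y, (((u₂ y - 4 * sZ (F₁ y) : ℤ)) : ℝ) = signOf b₂ * twist c₂ y * (1 - 4 * (if κ₂ y = true then 1 else 0)) + 8 * (v₂ y : ℝ))
    (y : Fin (6 + 6) → Bool) (T : ℤ) (hT : twist c₂ y = (T : ℝ)) :
    ∑ x, (v₁ x : ℝ) * twist x y =
      4 * (((sZ b₁ * (128 * (if y = c₁ then 1 else 0) - w (bxor c₁ y)) - 2 * sZ b₂ * T * (1 - 4 * (if κ₂ y = true then 1 else 0)) -
        16 * v₂ y : ℤ)) : ℝ) := by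
  classical
  have hm := topw_master F₁ F₂ u₁ u₂ v₁ v₂ hu₁ hu₂ κ₁ κ₂ b₁ b₂ c₁ c₂ h₁ h₂ y
  have hsignOf_ind : ∀ b : Bool, signOf b = 1 - 2 * (if b = true then (1 : ℝ) else 0) := fun b => by
    cases b <;> norm_num [signOf]
  have hW : W (fun x => signOf (κ₁ x)) (bxor c₁ y) =
      ∑ x, twist x (bxor c₁ y) - 2 * ∑ x ∈ univ.filter (fun x => κ₁ x = true), twist x (bxor c₁ y) := by
    show ∑ x, signOf (κ₁ x) * twist x (bxor c₁ y) = _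
    rw [sum_filter, mul_sum, ← sum_sub_distrib]
    refine sum_congr rfl fun x _ => ?_
    rw [hsignOf_ind]; split_ifs <;> ring
  rw [hw, sum_twist_left] at hW
  have hδ : (if bxor c₁ y = zeroVec then (2 : ℝ) ^ (6 + 6) else 0) = 4096 * (if y = c₁ then 1 else 0) := by
    by_cases hy : y = c₁
    · rw [if_pos hy, if_pos ((bxor_eq_zeroVec_iff c₁ y).2 hy.symm)]; norm_num
    · rw [if_neg hy, if_neg (fun h => hy ((bxor_eq_zeroVec_iff c₁ y).1 h).symm)]; norm_num
  rw [hδ] at hW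
  rw [hT, ← tp_sZ_cast b₁, ← tp_sZ_cast b₂] at hm
  have hs1 : ((sZ b₁ : ℤ) : ℝ) * ((sZ b₁ : ℤ) : ℝ) = 1 := by
    rcases tp_sZ_cases b₁ with h | h <;> rw [h] <;> norm_num
  push_cast
  linear_combination (-(sZ b₁ : ℝ) / 2) * hm + ((sZ b₁ : ℝ) / 4) * hW -
    ((∑ x, (v₁ x : ℝ) * twist x y) + 8 * (sZ b₂ : ℝ) * (T : ℝ) * (1 - 4 * (if κ₂ y = true then (1 : ℝ) else 0)) + 64 * (v₂ y : ℝ)) * hs1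

/-- **Parity dichotomy for the wild function.**  In the setting of `topw_master` with `κ₁` CUBIC: either `v̂₁(y) = 4·(odd)` for EVERY `y`, or
`8 ∣ v̂₁(y)` for every `y` (`v̂₁(y) = Σ_x v₁(x)(−1)^{x·y}`).  [`v̂₁(y)/4 ≡ w(c₁ ⊕ y) (mod 2)` with `W_{κ₁} = 16w`, and the odd set of `w` is all or
nothing for a cubic on 12 bits, `TypeOTwelve.typeO_of_exists_odd`.]  Finite-slice statement, NOT summit progress. [this work] -/
theorem topp_parity_dichotomy (F₁ F₂ : (Fin (6 + 6) → Bool) → Bool) (u₁ u₂ v₁ v₂ : (Fin (6 + 6) → Bool) → ℤ)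
    (hu₁ : ∀ x, W (fun y => signOf (F₁ y)) x = (2 : ℝ) ^ 4 * (u₁ x : ℝ))
    (hu₂ : ∀ y, W (fun x => signOf (F₂ x)) y = (2 : ℝ) ^ 4 * (u₂ y : ℝ))
    (κ₁ κ₂ : (Fin (6 + 6) → Bool) → Bool) (hκ₁ : IsDegLeFun 3 κ₁) (b₁ b₂ : Bool) (c₁ c₂ : Fin (6 + 6) → Bool)
    (h₁ : ∀ x, (((u₁ x - 4 * sZ (F₂ x) : ℤ)) : ℝ) = signOf b₁ * twist c₁ x * (1 - 4 * (if κ₁ x = true then 1 else 0)) + 8 * (v₁ x : ℝ))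
    (h₂ : ∀ y, (((u₂ y - 4 * sZ (F₁ y) : ℤ)) : ℝ) = signOf b₂ * twist c₂ y * (1 - 4 * (if κ₂ y = true then 1 else 0)) + 8 * (v₂ y : ℝ)) :
    (∀ y, ∃ k : ℤ, Odd k ∧ ∑ x, (v₁ x : ℝ) * twist x y = 4 * (k : ℝ)) ∨
      (∀ y, ∃ k : ℤ, ∑ x, (v₁ x : ℝ) * twist x y = 8 * (k : ℝ)) := by
  classical
  obtain ⟨w, hw⟩ := tw_base (n := 6 + 6) κ₁ hκ₁ 4 (by norm_num)
  -- the integer `k(y)` and its parity `≡ w(c₁ ⊕ y)`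
  have hT : ∀ y, ∃ T : ℤ, Odd T ∧ twist c₂ y = (T : ℝ) := fun y => by
    rcases Literature.Computability.QuantumComplexity.Simon.twist_eq_one_or c₂ y with h | h
    · exact ⟨1, odd_one, by rw [h]; norm_num⟩
    · exact ⟨-1, by decide, by rw [h]; norm_num⟩
  choose T hTodd hTeq using hT
  set k : (Fin (6 + 6) → Bool) → ℤ := fun y =>
    sZ b₁ * (128 * (if y = c₁ then 1 else 0) - w (bxor c₁ y)) - 2 * sZ b₂ * T y * (1 - 4 * (if κ₂ y = true then 1 else 0)) - 16 * v₂ y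
    with hk
  have hkf : ∀ y, ∑ x, (v₁ x : ℝ) * twist x y = 4 * (k y : ℝ) := fun y =>
    topp_vhat_formula F₁ F₂ u₁ u₂ v₁ v₂ w hu₁ hu₂ κ₁ κ₂ hw b₁ b₂ c₁ c₂ h₁ h₂ y (T y) (hTeq y)
  have hpar : ∀ y, Odd (k y) ↔ Odd (w (bxor c₁ y)) := by
    intro y
    have hs := tp_sZ_cases b₁
    have hs' := tp_sZ_cases b₂
    have ho := Int.odd_iff.1 (hTodd y)
    simp only [hk]
    rw [Int.odd_iff, Int.odd_iff]
    rcases hs with h | h <;> rcases hs' with h' | h' <;> rw [h, h'] <;> split_ifs <;> omega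
  by_cases hO : ∃ z, Odd (w z)
  · left
    have hall := Summit.QuantumAdvantage.QuantumAdvantage.Theorems.NearExactIsExact.Negative.TypeOTwelve.typeO_of_exists_odd κ₁ w hκ₁ hw hO
    intro y
    exact ⟨k y, (hpar y).2 (hall _), hkf y⟩
  · right
    push Not at hO
    intro y
    have hev : Even (k y) := by
      have := hO (bxor c₁ y)
      rw [Int.not_odd_iff_even] at this
      by_contra hne
      exact (Int.not_odd_iff_even.2 this) ((hpar y).1 (Int.not_even_iff_odd.1 hne))
    obtain ⟨j, hj⟩ := hev
    exact ⟨j, by rw [hkf y, hj]; push_cast; ring⟩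

end Summit.QuantumAdvantage.QuantumAdvantage.Theorems.CubicForrelation.NearExactIsExact

end
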